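import Summits.KontsevichZagierPeriods.KontsevichZagierPeriods.Theorems.HurwitzMicroSectorsNormalFormPrincipleLevelOneExistsTriangleRep

/-!
# `NormalFormPrinciple` (stmt-KontsevichZagierPeriods-3869), line `SketchIdeator1` —
# the leaf `stub_boxRigidity` in dimension two, level `N`: the triangle representations exist

Pure proof file (stub `exists_triangleRep_levelN` of the dimension-two, level-`N` layer, lead seat
c7; `--supports` the crux). The merge gadget `(x₀, x₁) ↦ (x₀, x₀x₁)` sends an off-diagonal monomial
`c·x₀^a x₁^b/(1 − (x₀x₁)^N)` (`a > b`) of the level-`N` family `[(0,1)², P/(1 − (x₀x₁)^N)]` onto the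
closed-fibre TRIANGLE `T = {0 < z₀ < 1, 0 ≤ z₁ ≤ z₀}` (a band over the open unit interval of `ℝ¹`,
`KZlog.band`) with the integrand `g_N(z) = c·z₀^{a−b−1} z₁^b/(1 − z₁^N)`. We show that `[T, g_N]`
is an integral representation of the tree's Kontsevich–Zagier calculus (`KZ.IntegralRep 2`):

* `T` is `ℚ`-semialgebraic (`LevelOne.isSemialgebraic_triangleBand`);
* `g_N` is a quotient of `ℚ`-polynomials whose denominator `1 − z₁^N ≥ 1 − z₁ ≥ 1 − z₀ > 0`
  (`N ≥ 1`) does not vanish on `T` (`isSemialgebraicFunOn_aeval_div_aeval`);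
* absolute convergence by DOMINATION from level one: on `T`, `0 ≤ z₁ < 1`, so `z₁^N ≤ z₁` and
  `|g_N| ≤ |g_1|`, where `g_1 = c·z₀^{a−b−1} z₁^b/(1 − z₁)` is integrable on `T`
  (`LevelOne.integrableOn_triangleIntegrand`, Beukers' integral after the merge change of variables).

Sources: M. Kontsevich, D. Zagier, *Periods* (2001), §1.1–1.2; F. Beukers, *A note on the
irrationality of ζ(2) and ζ(3)*, Bull. LMS 11 (1979). No definitions are introduced.
-/

noncomputable section

open MeasureTheory Set
open Literature.NumberTheory.Transcendental Literature.NumberTheory.Transcendental.KZ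
open Literature.ModelTheory.ExponentialFields (IsSemialgebraic)

namespace Summit.KontsevichZagierPeriods.HurwitzMicroSectors.NormalFormPrinciple.PiBox.LevelN

/-! ## The level-`N` triangle integrand -/

/-- On the triangle `T = {0 < z₀ < 1, 0 ≤ z₁ ≤ z₀}` the level-`N` denominator dominates the
level-one denominator: `0 < 1 − z₁ ≤ 1 − z₁^N` (`N ≥ 1`, since `0 ≤ z₁ < 1` gives `z₁^N ≤ z₁`).
[folklore] -/
theorem one_sub_pow_denominator_bounds {N : ℕ} (hN : 1 ≤ N) {z : Fin 2 → ℝ}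
    (hz : z ∈ KZlog.band {y : Fin 1 → ℝ | 0 < y 0 ∧ y 0 < 1} (fun _ => (0:ℝ)) (fun y => y 0)) :
    0 < 1 - z 1 ∧ 1 - z 1 ≤ 1 - z 1 ^ N := by
  have h : (0 < z 0 ∧ z 0 < 1) ∧ 0 ≤ z 1 ∧ z 1 ≤ z 0 := hz
  have h1 : z 1 < 1 := h.2.2.trans_lt h.1.2
  have hp : z 1 ^ N ≤ z 1 := pow_le_of_le_one h.2.1 h1.le (by omega)
  exact ⟨sub_pos.2 h1, by linarith⟩

/-- **Semialgebraicity of the level-`N` triangle integrand.** For `N ≥ 1`,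
`z ↦ c·z₀^{a−b−1} z₁^b/(1 − z₁^N)` is a `ℚ`-semialgebraic function on `T` (a quotient of
`ℚ`-polynomials whose denominator `1 − z₁^N ≥ 1 − z₀ > 0` does not vanish on `T`).
[Kontsevich–Zagier 2001, §1.1] [folklore] -/
theorem isSemialgebraicFunOn_triangleIntegrand_levelN {N : ℕ} (hN : 1 ≤ N) (a b : ℕ) (c : ℚ) :
    IsSemialgebraicFunOn ℚ
      (KZlog.band {y : Fin 1 → ℝ | 0 < y 0 ∧ y 0 < 1} (fun _ => (0:ℝ)) (fun y => y 0))
      (fun z => (c : ℝ) * (z 0 ^ (a - b - 1) * z 1 ^ b) / (1 - z 1 ^ N)) := by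
  refine (isSemialgebraicFunOn_aeval_div_aeval LevelOne.isSemialgebraic_triangleBand
    (MvPolynomial.C c * (MvPolynomial.X 0 ^ (a - b - 1) * MvPolynomial.X 1 ^ b))
    (1 - MvPolynomial.X 1 ^ N) fun z hz => ?_).congr fun z _ => by simp
  have h := one_sub_pow_denominator_bounds hN hz
  simp only [map_sub, map_one, map_pow, MvPolynomial.aeval_X]
  exact (h.1.trans_le h.2).ne'

/-- **Absolute convergence of the level-`N` triangle integrand** (`N ≥ 1`), by domination from
level one: on `T`, `|c·z₀^{a−b−1} z₁^b/(1 − z₁^N)| ≤ |c·z₀^{a−b−1} z₁^b/(1 − z₁)|`, and the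
right-hand side is integrable on `T` (`LevelOne.integrableOn_triangleIntegrand`).
[Kontsevich–Zagier 2001, §1.2 rule (2)] [folklore] -/
theorem integrableOn_triangleIntegrand_levelN {N : ℕ} (hN : 1 ≤ N) (a b : ℕ) (c : ℚ) :
    IntegrableOn (fun z : Fin 2 → ℝ => (c : ℝ) * (z 0 ^ (a - b - 1) * z 1 ^ b) / (1 - z 1 ^ N))
      (KZlog.band {y : Fin 1 → ℝ | 0 < y 0 ∧ y 0 < 1} (fun _ => (0:ℝ)) (fun y => y 0)) := by
  have hTm : MeasurableSet
      (KZlog.band {y : Fin 1 → ℝ | 0 < y 0 ∧ y 0 < 1} (fun _ => (0:ℝ)) (fun y => y 0)) :=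
    IsSemialgebraic.measurableSet_holds LevelOne.isSemialgebraic_triangleBand
  refine Integrable.mono (LevelOne.integrableOn_triangleIntegrand a b c)
    (Measurable.aestronglyMeasurable (by fun_prop)) (ae_restrict_of_forall_mem hTm fun z hz => ?_)
  have h := one_sub_pow_denominator_bounds hN hz
  rw [Real.norm_eq_abs, Real.norm_eq_abs, abs_div, abs_div, abs_of_pos h.1,
    abs_of_pos (h.1.trans_le h.2)]
  exact div_le_div_of_nonneg_left (abs_nonneg _) h.1 h.2

/-- **V2 (existence of the level-`N` triangle representation).** For `N ≥ 1`, `a > b` and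
`c ∈ ℚ` there is an integral representation of dimension `2` with domain the closed-fibre triangle
`T = {0 < z₀ < 1, 0 ≤ z₁ ≤ z₀}` and integrand `z ↦ c·z₀^{a−b−1} z₁^b/(1 − z₁^N)` — the image of the
box monomial `c·x₀^a x₁^b/(1 − (x₀x₁)^N)` under the merge gadget `(x₀, x₁) ↦ (x₀, x₀x₁)`.
[Kontsevich–Zagier 2001, §1.1–1.2] [folklore] -/
theorem exists_triangleRep_levelN (N : ℕ) (hN : 1 ≤ N) (a b : ℕ) (c : ℚ) (hab : b < a) :
    ∃ R : IntegralRep 2,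
      R.domain = KZlog.band {y : Fin 1 → ℝ | 0 < y 0 ∧ y 0 < 1} (fun _ => (0:ℝ)) (fun y => y 0) ∧
      R.integrand = fun z => (c : ℝ) * (z 0 ^ (a - b - 1) * z 1 ^ b) / (1 - z 1 ^ N) := by
  have _ := hab -- existence does not need `b < a` (for `b ≥ a` the exponent `a - b - 1` is `0`)
  exact ⟨⟨_, _, LevelOne.isSemialgebraic_triangleBand,
    isSemialgebraicFunOn_triangleIntegrand_levelN hN a b c,
    integrableOn_triangleIntegrand_levelN hN a b c⟩, rfl, rfl⟩

end Summit.KontsevichZagierPeriods.HurwitzMicroSectors.NormalFormPrinciple.PiBox.LevelN
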